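import Summits.HubbardSuperconductivity.HubbardLadder.NeelSignC02K0
import Summits.HubbardSuperconductivity.HubbardLadder.NeelSignPatternC02R1
import Summits.HubbardSuperconductivity.HubbardLadder.NeelSignPatternC02R2
import Summits.HubbardSuperconductivity.HubbardLadder.NeelSignPatternC02R3
import Literature.Barriers.HubbardSuperconductivity.InfraredBoundNeelSpinHalf2D
import HarnessLib

/-!
# The Néel sign pattern of the square-lattice Heisenberg antiferromagnet, uniformly in the side: `c_L(0,2) > 0` (HubbardLadder R2, H₀ line; device D39)

HONEST FRAMING: ladder R1–R4 with certified numbers; no claim on H/H₀.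

`heisRedCorr2_C02_sign (k) (hk : 7 ≤ k) : (1/1250 : ℝ) ≤ heisRedCorr2 (2 * k) 1 0 2` — for EVERY
torus `(ℤ/2kℤ)²`, `k ≥ 7`, in
the ground state(s) of the spin-½ Heisenberg antiferromagnet (`heisRedCorr2 L 1 a b = ω_L(S₀^z
S_(a,b)^z)`
averaged over the ground space, tree definition).  Proof: linear-programming duality,
every row a tree
theorem — the Kennedy–Lieb–Shastry window-dictionary infrared cut
(`kls_heis_windowDict_cut_spinHalf`) for
the kernel `NeelSign.C02K0` with its `L`-uniform constant `W̄ = 200295174621/274877906944`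
(`NeelSignC02K0.lean`), the Gram-window
rows `gramC02_*` (`NeelSignPatternC02R*.lean`), `c(0,0) = 1/4`, `|c| ≤ 1/4`, `-1/8 ≤ c(0,1) ≤ -1/12`
(`Literature.Barriers…neg_heisBondCorr_spinHalf_le`, `heisBondCorr_le`); the dual multipliers were read
off the LP optimum (`pub-hubbard-r2/rplp/d39/final2.py`,
kit jobs in the README) and the final inequality
is `linarith` over the instantiated rows (exact dual bound recomputed in rational arithmetic by
`rplp/d39/asm39.py`).  Companions: `c_L(1,1) ≥ 0.0126` uniformly (D35,
request #178) and the finite-torus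
windows of pub-hubbard R2.  No claim whatsoever about the Hubbard model or about `L → ∞` order.
[cite: KLS1988JSP, eqs. (4), (6)-(9); DLS1978, Thm 3.2, App. C]
-/

namespace Summit.HubbardSuperconductivity.HubbardLadder

open Finset Literature.MathematicalPhysics.QuantumLattice Literature.Probability.LatticeModels

/-- Swap normal form for the reduced correlations: `c(a,b) = c(b,a)` whenever `b < a` — a CONDITIONAL rewrite
rule (`simp (disch := decide)` discharges the numeral side condition) that brings every `heisRedCorr2 L n a b` to the canonical
order `a ≤ b`. Filer's replacement (LEAN FILING REQUEST #190/#194/#200) of the generator's file-local tactic macro,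
which the gate does not admit (`lint.code-exec`); no statement of this file is changed. [folklore] -/
private theorem heisRedCorr2_swap_of_lt (L : ℕ) [NeZero L] (n a b : ℕ) (_h : b < a) :
    heisRedCorr2 L n a b = heisRedCorr2 L n b a := heisRedCorr2_swap L n a b

set_option maxHeartbeats 2000000 in
/-- Row `K0` of the `C02` certificate: the Kennedy–Lieb–Shastry window-dictionary cut
(`kls_heis_windowDict_cut_spinHalf`) for the kernel `NeelSign.C02K0` (certified constant `W̄ =
200295174621/274877906944`) at `x₀ = 1/4`.
[cite: KLS1988JSP, eqs. (4), (6)-(9); DLS1978, App. C] -/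
theorem irC02_0 (k : ℕ) (hk : 7 ≤ k) :
    haveI : NeZero (2 * k) := ⟨by omega⟩
    (30912401885/274877906944 : ℝ) * heisRedCorr2 (2 * k) 1 0 1 - (-36464897571/2199023255552 : ℝ) ≤
      (1 : ℝ) * heisRedCorr2 (2 * k) 1 0 2 + (39/1024 : ℝ) * heisRedCorr2 (2 * k) 1 0 3 +
      (-1/512 : ℝ) * heisRedCorr2 (2 * k) 1 0 4 + (13/128 : ℝ) * heisRedCorr2 (2 * k) 1 0 5 +
      (-1/64 : ℝ) * heisRedCorr2 (2 * k) 1 1 1 + (-471/1024 : ℝ) * heisRedCorr2 (2 * k) 1 1 2 +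
      (147/1024 : ℝ) * heisRedCorr2 (2 * k) 1 1 3 + (39/256 : ℝ) * heisRedCorr2 (2 * k) 1 1 4 +
      (-61/256 : ℝ) * heisRedCorr2 (2 * k) 1 2 2 + (-11/1024 : ℝ) * heisRedCorr2 (2 * k) 1 2 3 := by
  haveI : NeZero (2 * k) := ⟨by omega⟩
  have hK := kls_heis_windowDict_cut_spinHalf k (by omega) NeelSign.C02K0.S NeelSign.C02K0.w
    (b := (631/1024 : ℝ)) (t := (-441/1024 : ℝ)) (Wbar := (200295174621/274877906944 : ℝ)) (x₀ :=
        (1/4 : ℝ)) (by norm_num)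
    NeelSign.C02K0.KQ_nonneg (NeelSign.C02K0.riemannSum_le k (by omega))
  rw [NeelSign.C02K0.S, Finset.sum_insert (by decide), Finset.sum_insert (by decide),
      Finset.sum_insert (by decide), Finset.sum_insert (by decide), Finset.sum_insert (by decide),
      Finset.sum_insert (by decide), Finset.sum_insert (by decide), Finset.sum_insert (by decide),
      Finset.sum_insert (by decide), Finset.sum_insert (by decide), Finset.sum_insert (by decide),
      Finset.sum_insert (by decide), Finset.sum_insert (by decide), Finset.sum_insert (by decide),
      Finset.sum_insert (by decide), Finset.sum_insert (by decide), Finset.sum_insert (by decide),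
      Finset.sum_singleton] at hK
  simp only [NeelSign.C02K0.w] at hK
  try simp (disch := decide) only [heisRedCorr2_swap_of_lt] at hK
  norm_num at hK ⊢
  linarith [hK]

set_option maxHeartbeats 4000000 in
/-- **DEVICE D39 (C02)**: in the ground state of the spin-½ Heisenberg antiferromagnet on the torus
`(ℤ/2kℤ)²`, the
second-neighbour axis correlation `c_L(0,2)` is POSITIVE,
uniformly in the side — `(1/1250 : ℝ) ≤ heisRedCorr2 (2k) 1 0 2` for every
`k ≥ 7` (the Néel sign pattern `sign c(a,b) = (-1)^(a+b)` at this separation).  Proof = LP duality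
over 1 Kennedy–Lieb–Shastry
window-dictionary cut(s) (`irC02_*`, kernel constants certified in `NeelSign.C02K*`),
18 Gram-window rows (`gramC02_*`),
`c(0,0) = 1/4`, `|c(a,b)| ≤ 1/4`, `-1/8 ≤ c(0,1) ≤ -1/12` (infrared a-priori bound / Anderson bound); exact dual bound
`1405518314897057436639435704870459119 / 1677721600000000000000000000000000000000`
(≈ 0.0008378), rounded down to `1/1250`.  HONEST FRAMING: ladder R1–R4 with certified numbers; no claim on H/H₀.
[cite: KLS1988JSP, eqs. (4), (6)-(9); DLS1978, Thm 3.2, App. C] -/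
theorem heisRedCorr2_C02_sign (k : ℕ) (hk : 7 ≤ k) :
    haveI : NeZero (2 * k) := ⟨by omega⟩
    (1/1250 : ℝ) ≤ heisRedCorr2 (2 * k) 1 0 2 := by
  haveI : NeZero (2 * k) := ⟨by omega⟩
  have h00 : heisRedCorr2 (2 * k) 1 0 0 = 1 / 4 := by rw [heisRedCorr2_zero_zero]; norm_num
  have hε : heisRedCorr2 (2 * k) 1 0 1 ≤ -1 / 12 := by
    have h1 := heisBondCorr_le (d := 2) (by norm_num) 1 k (by omega)
    rw [heisBondCorr_two_eq, heisRedCorr2_swap (2 * k) 1 1 0] at h1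
    norm_num at h1 ⊢
    linarith
  have hεlo : -1 / 8 ≤ heisRedCorr2 (2 * k) 1 0 1 := by
    have h1 := Literature.Barriers.HubbardSuperconductivity.neg_heisBondCorr_spinHalf_le (d := 2)
        (by norm_num) (2 * k) (by omega)
    rw [heisBondCorr_two_eq, heisRedCorr2_swap (2 * k) 1 1 0] at h1
    norm_num at h1 ⊢
    linarith
  have hb_0_1 : |heisRedCorr2 (2 * k) 1 0 1| ≤ 1 / 4 := by
    have := heisRedCorr2_abs_le (2 * k) 1 0 1
    norm_num at this ⊢
    exact this
  obtain ⟨hl_0_1, hu_0_1⟩ := abs_le.mp hb_0_1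
  have hb_0_2 : |heisRedCorr2 (2 * k) 1 0 2| ≤ 1 / 4 := by
    have := heisRedCorr2_abs_le (2 * k) 1 0 2
    norm_num at this ⊢
    exact this
  obtain ⟨hl_0_2, hu_0_2⟩ := abs_le.mp hb_0_2
  have hb_0_3 : |heisRedCorr2 (2 * k) 1 0 3| ≤ 1 / 4 := by
    have := heisRedCorr2_abs_le (2 * k) 1 0 3
    norm_num at this ⊢
    exact this
  obtain ⟨hl_0_3, hu_0_3⟩ := abs_le.mp hb_0_3
  have hb_0_4 : |heisRedCorr2 (2 * k) 1 0 4| ≤ 1 / 4 := by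
    have := heisRedCorr2_abs_le (2 * k) 1 0 4
    norm_num at this ⊢
    exact this
  obtain ⟨hl_0_4, hu_0_4⟩ := abs_le.mp hb_0_4
  have hb_0_5 : |heisRedCorr2 (2 * k) 1 0 5| ≤ 1 / 4 := by
    have := heisRedCorr2_abs_le (2 * k) 1 0 5
    norm_num at this ⊢
    exact this
  obtain ⟨hl_0_5, hu_0_5⟩ := abs_le.mp hb_0_5
  have hb_1_1 : |heisRedCorr2 (2 * k) 1 1 1| ≤ 1 / 4 := by
    have := heisRedCorr2_abs_le (2 * k) 1 1 1
    norm_num at this ⊢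
    exact this
  obtain ⟨hl_1_1, hu_1_1⟩ := abs_le.mp hb_1_1
  have hb_1_2 : |heisRedCorr2 (2 * k) 1 1 2| ≤ 1 / 4 := by
    have := heisRedCorr2_abs_le (2 * k) 1 1 2
    norm_num at this ⊢
    exact this
  obtain ⟨hl_1_2, hu_1_2⟩ := abs_le.mp hb_1_2
  have hb_1_3 : |heisRedCorr2 (2 * k) 1 1 3| ≤ 1 / 4 := by
    have := heisRedCorr2_abs_le (2 * k) 1 1 3
    norm_num at this ⊢
    exact this
  obtain ⟨hl_1_3, hu_1_3⟩ := abs_le.mp hb_1_3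
  have hb_1_4 : |heisRedCorr2 (2 * k) 1 1 4| ≤ 1 / 4 := by
    have := heisRedCorr2_abs_le (2 * k) 1 1 4
    norm_num at this ⊢
    exact this
  obtain ⟨hl_1_4, hu_1_4⟩ := abs_le.mp hb_1_4
  have hb_1_5 : |heisRedCorr2 (2 * k) 1 1 5| ≤ 1 / 4 := by
    have := heisRedCorr2_abs_le (2 * k) 1 1 5
    norm_num at this ⊢
    exact this
  obtain ⟨hl_1_5, hu_1_5⟩ := abs_le.mp hb_1_5
  have hb_2_2 : |heisRedCorr2 (2 * k) 1 2 2| ≤ 1 / 4 := by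
    have := heisRedCorr2_abs_le (2 * k) 1 2 2
    norm_num at this ⊢
    exact this
  obtain ⟨hl_2_2, hu_2_2⟩ := abs_le.mp hb_2_2
  have hb_2_3 : |heisRedCorr2 (2 * k) 1 2 3| ≤ 1 / 4 := by
    have := heisRedCorr2_abs_le (2 * k) 1 2 3
    norm_num at this ⊢
    exact this
  obtain ⟨hl_2_3, hu_2_3⟩ := abs_le.mp hb_2_3
  have hb_2_4 : |heisRedCorr2 (2 * k) 1 2 4| ≤ 1 / 4 := by
    have := heisRedCorr2_abs_le (2 * k) 1 2 4
    norm_num at this ⊢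
    exact this
  obtain ⟨hl_2_4, hu_2_4⟩ := abs_le.mp hb_2_4
  have hb_2_5 : |heisRedCorr2 (2 * k) 1 2 5| ≤ 1 / 4 := by
    have := heisRedCorr2_abs_le (2 * k) 1 2 5
    norm_num at this ⊢
    exact this
  obtain ⟨hl_2_5, hu_2_5⟩ := abs_le.mp hb_2_5
  have hb_3_3 : |heisRedCorr2 (2 * k) 1 3 3| ≤ 1 / 4 := by
    have := heisRedCorr2_abs_le (2 * k) 1 3 3
    norm_num at this ⊢
    exact this
  obtain ⟨hl_3_3, hu_3_3⟩ := abs_le.mp hb_3_3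
  have hb_3_4 : |heisRedCorr2 (2 * k) 1 3 4| ≤ 1 / 4 := by
    have := heisRedCorr2_abs_le (2 * k) 1 3 4
    norm_num at this ⊢
    exact this
  obtain ⟨hl_3_4, hu_3_4⟩ := abs_le.mp hb_3_4
  have hb_3_5 : |heisRedCorr2 (2 * k) 1 3 5| ≤ 1 / 4 := by
    have := heisRedCorr2_abs_le (2 * k) 1 3 5
    norm_num at this ⊢
    exact this
  obtain ⟨hl_3_5, hu_3_5⟩ := abs_le.mp hb_3_5
  have hb_4_4 : |heisRedCorr2 (2 * k) 1 4 4| ≤ 1 / 4 := by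
    have := heisRedCorr2_abs_le (2 * k) 1 4 4
    norm_num at this ⊢
    exact this
  obtain ⟨hl_4_4, hu_4_4⟩ := abs_le.mp hb_4_4
  have hb_4_5 : |heisRedCorr2 (2 * k) 1 4 5| ≤ 1 / 4 := by
    have := heisRedCorr2_abs_le (2 * k) 1 4 5
    norm_num at this ⊢
    exact this
  obtain ⟨hl_4_5, hu_4_5⟩ := abs_le.mp hb_4_5
  have hb_5_5 : |heisRedCorr2 (2 * k) 1 5 5| ≤ 1 / 4 := by
    have := heisRedCorr2_abs_le (2 * k) 1 5 5
    norm_num at this ⊢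
    exact this
  obtain ⟨hl_5_5, hu_5_5⟩ := abs_le.mp hb_5_5
  have irC02_0' := irC02_0 k hk
  have g0 := gramC02_0 k (by omega)
  have g1 := gramC02_1 k (by omega)
  have g2 := gramC02_2 k (by omega)
  have g3 := gramC02_3 k (by omega)
  have g4 := gramC02_4 k (by omega)
  have g5 := gramC02_5 k (by omega)
  have g6 := gramC02_6 k (by omega)
  have g7 := gramC02_7 k (by omega)
  have g8 := gramC02_8 k (by omega)
  have g9 := gramC02_9 k (by omega)
  have g10 := gramC02_10 k (by omega)
  have g11 := gramC02_11 k (by omega)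
  have g12 := gramC02_12 k (by omega)
  have g13 := gramC02_13 k (by omega)
  have g14 := gramC02_14 k (by omega)
  have g15 := gramC02_15 k (by omega)
  have g16 := gramC02_16 k (by omega)
  have g17 := gramC02_17 k (by omega)
  linarith

end Summit.HubbardSuperconductivity.HubbardLadder
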